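import Literature.IUT.HodgeArakelov.AbsTopMonoidsGenuineIsometries
import Literature.AnabelianGeometry.AbsoluteAnabelian.GaloisPadicLogLatticeLinear
import HarnessLib

/-!
# [IUTchII] Example 1.8 (iv): `Γ^{×μ} = Im(Ẑ^×)` is preserved — pointwise — by arbitrary isomorphisms
# `G₁ ⥲ G₂` at the GENUINE producer (proof-only; row «ZHAT-NAT»)

S. Mochizuki, *Inter-universal Teichmüller theory II*, §1, Example 1.8 (iv), kurims manuscript (Dec. 2020) p. 39
[claim: Mochizuki2012, status: disputed] (IUTchII §1 Ex 1.8 (iv), kurims p.39): "Let `Γ^{×μ} ⊆ Ism(−)` be a closed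
subgroup, i.e., a collection of closed subgroups of each `Ism(G)` that is preserved by arbitrary isomorphisms of
topological groups `G₁ ⥲ G₂` … another example of such a `Γ^{×μ}` is the image `Im(Ẑ^×)` of the natural homomorphism
`Ẑ^× ↠ ℤ_p^× ↪ Ism`."  abc-iut cell, layer L6, row «ZHAT-NAT» (abc-iut-w6-d011's 07:06Z by-name offer «Ẑ^×-NATURALITY
at the genuine producer»; abc-iut-L6-d2's 07:59:01Z note "the second printed example … needs «liftM commutes with
the `ℤ_p^×`-powers»"); seat abc-iut-w6-d104.  PROOF-ONLY over abc-iut-L6-d2's `AbsTopMonoidsGenuineIsometries.lean`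
(`Genuine.zhatOxmu`, `oxmuBridge`, `genuineOfModelIsm`, p427597), abc-iut-L6-t13's `AbsTopMonoidsGenuineProducer.lean`
(`Genuine.liftM`, `liftM_spec`) and this seat's `GaloisPadicLogLatticeLinear.lean`
(`MLFClosure.map_zpPow_eq_of_mapsTo_fixed`: automatic `ℤ_p`-linearity into `p`-adically separated lattices).

* `Genuine.coe_smul_eq`, `Genuine.smul_eq_of_apply_eq` — the `Gal(k̄/k)`-action on `𝒪_k̄^⊳` read in `k̄`;
* `Genuine.liftM_fixed_of_fixed` — THE lift `liftM(φ)` of a topological automorphism `φ` of `Gal(k̄/k)` carries the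
  `H`-fixed elements of `𝒪_k̄^⊳` to `φ(H)`-fixed elements (`φ`-equivariance `liftM_spec`);
* **`Genuine.liftM_zpPow_comm`** — on `k~ = 𝒪_k̄^×⧸𝒪_k̄^μ`, the automorphism induced by `liftM(φ)` COMMUTES with every
  `ℤ_p^×`-power `MLFClosure.zpPow a`: for a unit `w`, take `H :=` the (open) stabiliser of `w`, `H' := φ(H)` (open,
  `φ` a homeomorphism); `liftM(φ)` maps the lattice of `H` into that of `H'`, so `map_zpPow_eq_of_mapsTo_fixed` applies;
* **`Genuine.liftM_zhatOxmu_comm`** — the same on `O^{×μ} = (𝒪_k̄^⊳)ˣ⧸μ` for the `Ẑ^×`-action `zhatOxmu`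
  (`Ẑ^× ↠ ℤ_p^×` followed by the powers, transported along `oxmuBridge`);
* **`genuineOfModelIsm_congr_actIsm_toIsm`** — at the fully genuine `AbsTopMonoids` producer
  `genuineOfModelIsm S C ε hΔ hq`: for every `f : G ⟶ H` in `IsoClass G_k` and `u ∈ Ẑ^×`, conjugating the isometry
  `toIsm G u` of `O^{×μ}(G)` by the isomorphism `O^{×μ}(f)` induced by the transport `O^⊳(f) = liftM(…)` gives
  `toIsm H u` — **the collection `Γ^{×μ} := Im(Ẑ^× → Ism(−))` is preserved (indeed fixed pointwise) by arbitrary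
  isomorphisms `G₁ ⥲ G₂`**, the second printed example of [IUTchII] Ex. 1.8 (iv), complementing abc-iut-L6-d2's
  `AbsTopMonoids.congr_mem_ism` (the first example `Γ^{×μ} := Ism(−)`, p431720).

HONEST FRAMING: record-only under a disputed claim key; the content is classical (`p`-adic logarithm, Krull topology,
`End_ℤ` of `ℤ_p`-lattices); nothing here bears on [IUTchIII] Cor. 3.12; typed ≠ endorsed.
-/

set_option autoImplicit false

noncomputable section

namespace Literature.IUT.HodgeArakelov

open CategoryTheory
open Literature.AnabelianGeometry.AbsoluteAnabelian
open Literature.AnabelianGeometry.EtaleTheta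

namespace AbsTopMonoids

namespace Genuine

variable (C : MLFClosure.{0})

/-! ## The Galois action on `𝒪_k̄^⊳`, read in `k̄` -/

/-- For the mono-analytic model data, `σ ∈ Gal(k̄/k)` acts on `x ∈ 𝒪_k̄^⊳` by the field automorphism: `(σ • x : k̄) = σ x`.
[cite: MochizukiAbsTopIII2015, Definition 3.1 (i) p.67] -/
theorem coe_smul_eq (σ : (ModelMLFGaloisData.galois C.k C.K).tmPair.Pi)
    (x : (ModelMLFGaloisData.galois C.k C.K).tmPair.M) :
    ((σ • x : (ModelMLFGaloisData.galois C.k C.K).tmPair.M) : C.K) =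
      (ModelMLFGaloisData.galois C.k C.K).aug σ ((x : nonzeroIntegers C.k C.K) : C.K) :=
  rfl

/-- If `σ` fixes the underlying element of `k̄`, it fixes `x ∈ 𝒪_k̄^⊳`. [cite: MochizukiAbsTopIII2015, Definition 3.1 (i) p.67] -/
theorem smul_eq_of_apply_eq (σ : (ModelMLFGaloisData.galois C.k C.K).tmPair.Pi)
    (x : (ModelMLFGaloisData.galois C.k C.K).tmPair.M)
    (h : (ModelMLFGaloisData.galois C.k C.K).aug σ ((x : nonzeroIntegers C.k C.K) : C.K) =
      ((x : nonzeroIntegers C.k C.K) : C.K)) :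
    σ • x = x :=
  Subtype.ext h

/-! ## `liftM(φ)` carries `H`-fixed elements to `φ(H)`-fixed elements -/

/-- **`φ`-equivariance on fixed points**: if `x ∈ 𝒪_k̄^⊳` is fixed (in `k̄`) by every `σ ∈ H`, then `liftM(φ) x` is
fixed by every element of `φ(H)` (`liftM_spec`: `liftM (σ • x) = φ σ • liftM x`).
[cite: MochizukiAbsTopIII2015, Proposition 3.2 (iv) p.72] -/
theorem liftM_fixed_of_fixed
    (φ : (ModelMLFGaloisData.galois C.k C.K).tmPair.Pi ≃ₜ* (ModelMLFGaloisData.galois C.k C.K).tmPair.Pi)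
    (H : Subgroup (C.K ≃ₐ[C.k] C.K)) (x : (ModelMLFGaloisData.galois C.k C.K).tmPair.M)
    (hx : ∀ σ ∈ H, σ ((x : nonzeroIntegers C.k C.K) : C.K) = ((x : nonzeroIntegers C.k C.K) : C.K))
    (σ' : C.K ≃ₐ[C.k] C.K) (hσ' : σ' ∈ H.map φ.toMonoidHom) :
    σ' ((liftM C φ x : nonzeroIntegers C.k C.K) : C.K) = ((liftM C φ x : nonzeroIntegers C.k C.K) : C.K) := by
  obtain ⟨σ, hσ, rfl⟩ := Subgroup.mem_map.mp hσ'
  have h1 : liftM C φ (σ • x) = φ σ • liftM C φ x := liftM_spec C φ σ x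
  rw [smul_eq_of_apply_eq C σ x (hx σ hσ)] at h1
  exact (congrArg (fun y : (ModelMLFGaloisData.galois C.k C.K).tmPair.M => ((y : nonzeroIntegers C.k C.K) : C.K)) h1).symm

/-! ## `liftM(φ)` commutes with the `ℤ_p^×`-powers on `k~` -/

variable [Fact C.residueChar.Prime]

/-- **On `k~ = 𝒪_k̄^× ⧸ 𝒪_k̄^μ`, the automorphism induced by `liftM(φ)` commutes with every `ℤ_p^×`-power.**  The
induced map is `T := oxmuBridge ∘ (liftM(φ) mod torsion) ∘ oxmuBridge⁻¹`; for the class of a unit `w` take `H :=`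
the stabiliser of `w` (open) and `H' := φ(H)` (open, `φ` a homeomorphism): `T` carries the lattice of `H` into the
lattice of `H'` (`liftM_fixed_of_fixed`), so `MLFClosure.map_zpPow_eq_of_mapsTo_fixed` — automatic `ℤ_p`-linearity
into the `p`-adically separated lattice of `H'` — gives the commutation at `[w]`.
[claim: Mochizuki2012, status: disputed] (IUTchII §1 Ex 1.8 (iv), kurims p.39) -/
theorem liftM_zpPow_comm
    (φ : (ModelMLFGaloisData.galois C.k C.K).tmPair.Pi ≃ₜ* (ModelMLFGaloisData.galois C.k C.K).tmPair.Pi)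
    (a : ℤ_[C.residueChar]ˣ) (y : unitGroup C.k C.K ⧸ CommGroup.torsion (unitGroup C.k C.K)) :
    oxmuBridge C (MulEquivModTorsion (Units.mapEquiv (liftM C φ)) ((oxmuBridge C).symm (C.zpPow a y))) =
      C.zpPow a (oxmuBridge C (MulEquivModTorsion (Units.mapEquiv (liftM C φ)) ((oxmuBridge C).symm y))) := by
  -- the induced endomorphism `T` of `k~`
  set T : (unitGroup C.k C.K ⧸ CommGroup.torsion (unitGroup C.k C.K)) →*
      (unitGroup C.k C.K ⧸ CommGroup.torsion (unitGroup C.k C.K)) :=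
    ((oxmuBridge C).toMonoidHom.comp (MulEquivModTorsion (Units.mapEquiv (liftM C φ))).toMonoidHom).comp
      (oxmuBridge C).symm.toMonoidHom with hT
  have hT_apply : ∀ z, T z = oxmuBridge C (MulEquivModTorsion (Units.mapEquiv (liftM C φ)) ((oxmuBridge C).symm z)) :=
    fun _ => rfl
  -- `T` on the class of a unit
  have hT_mk : ∀ u : unitGroup C.k C.K,
      T (QuotientGroup.mk u) = QuotientGroup.mk (unitsBridge C (Units.mapEquiv (liftM C φ) ((unitsBridge C).symm u))) := by
    intro u
    rw [hT_apply, oxmuBridge_symm_mk, mulEquivModTorsion_mk, oxmuBridge_mk]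
  induction y using QuotientGroup.induction_on with
  | H w =>
    rw [← hT_apply, ← hT_apply]
    -- the open stabiliser of `w` and its image under `φ`
    set Hs : Subgroup (C.K ≃ₐ[C.k] C.K) := MulAction.stabilizer (C.K ≃ₐ[C.k] C.K) ((w : (C.K)ˣ) : C.K) with hHs
    -- the stabiliser is open in the Krull topology (abc-iut-L4's `ModelMLFGaloisData.isOpen_stabilizer_comp` for the
    -- mono-analytic model data, whose augmentation is the identity; cf. `CohomologySystemOfContH1.isOpen_stabilizer_gal`)
    have hHopen : IsOpen (Hs : Set (C.K ≃ₐ[C.k] C.K)) := by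
      haveI : Algebra.IsAlgebraic C.k C.K := IsAlgClosure.isAlgebraic
      exact (ModelMLFGaloisData.galois C.k C.K).isOpen_stabilizer_comp _
    have hφopen : IsOpen ((Hs.map φ.toMonoidHom : Subgroup (C.K ≃ₐ[C.k] C.K)) : Set (C.K ≃ₐ[C.k] C.K)) := by
      rw [Subgroup.coe_map]
      exact φ.toHomeomorph.isOpenMap _ hHopen
    refine C.map_zpPow_eq_of_mapsTo_fixed T Hs (Hs.map φ.toMonoidHom) hφopen (fun u hu => ?_) w
      (fun σ hσ => by simpa [hHs, MulAction.mem_stabilizer_iff, AlgEquiv.smul_def] using hσ) a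
    -- `T` carries the `Hs`-lattice into the `φ(Hs)`-lattice
    refine ⟨unitsBridge C (Units.mapEquiv (liftM C φ) ((unitsBridge C).symm u)), fun σ' hσ' => ?_, hT_mk u⟩
    rw [coe_unitsBridge]
    change σ' ((liftM C φ (((unitsBridge C).symm u : (nonzeroIntegers C.k C.K)ˣ) : nonzeroIntegers C.k C.K) :
      nonzeroIntegers C.k C.K) : C.K) = _
    refine liftM_fixed_of_fixed C φ Hs _ (fun σ hσ => ?_) σ' hσ'
    rw [coe_unitsBridge_symm]
    exact hu σ hσ

/-- **`liftM(φ)` commutes with the `Ẑ^×`-action `zhatOxmu` on `O^{×μ} = (𝒪_k̄^⊳)ˣ⧸μ`** (`Ẑ^× ↠ ℤ_p^×` followed by the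
powers, transported along `oxmuBridge`): the isomorphism of `O^{×μ}` induced by THE lift of `φ` is `Ẑ^×`-equivariant.
[claim: Mochizuki2012, status: disputed] (IUTchII §1 Ex 1.8 (iv), kurims p.39) -/
theorem liftM_zhatOxmu_comm
    (φ : (ModelMLFGaloisData.galois C.k C.K).tmPair.Pi ≃ₜ* (ModelMLFGaloisData.galois C.k C.K).tmPair.Pi)
    (u : ZHatUnits) (x : ModTorsion (nonzeroIntegers C.k C.K)ˣ) :
    MulEquivModTorsion (Units.mapEquiv (liftM C φ)) (zhatOxmu C u x) =
      zhatOxmu C u (MulEquivModTorsion (Units.mapEquiv (liftM C φ)) x) := by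
  apply (oxmuBridge C).injective
  rw [oxmuBridge_zhatOxmu, zhatOxmu_apply]
  have h := liftM_zpPow_comm C φ (ZHatLevel.padicCharUnits C.residueChar u) (oxmuBridge C x)
  rw [MulEquiv.symm_apply_apply] at h
  exact h

end Genuine

/-! ## The genuine producer: `Γ^{×μ} = Im(Ẑ^×)` is preserved by arbitrary isomorphisms -/

section Producer

open Genuine

variable (S : ThetaSetting.{0}) (C : MLFClosure.{0}) (ε : S.Gk ≃ₜ* (ModelMLFGaloisData.galois C.k C.K).tmPair.Pi)
  (hΔ : ∀ f : S.PiX ≃ₜ* S.PiX, S.DeltaX.map f.toMulEquiv.toMonoidHom = S.DeltaX)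
  (hq : Nonempty (TopGroup.quot S.PiX S.DeltaX ≃ₜ* S.Gk))

/-- **The isomorphism `O^{×μ}(f)` induced by the transport `O^⊳(f)` of the genuine producer commutes with the
`Ẑ^×`-action**: `O^{×μ}(f) ∘ (u ·) = (u ·) ∘ O^{×μ}(f)` for every `f : G ⟶ H` in `IsoClass G_k` and `u ∈ Ẑ^×`
(`O^⊳(f) = liftM(…)`, `actIsm ∘ toIsm = zhatOxmu`). [claim: Mochizuki2012, status: disputed] (IUTchII §1 Ex 1.8 (iv), kurims p.39) -/
theorem genuineOfModelIsm_oxmuMap_actIsm_toIsm {G H : IsoClass S.Gk} (f : G ⟶ H) (u : ZHatUnits)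
    (x : (genuineOfModelIsm S C ε hΔ hq).Oxmu G) :
    MulEquivModTorsion (Units.mapEquiv ((genuineOfModelIsm S C ε hΔ hq).mapOtri f))
        ((genuineOfModelIsm S C ε hΔ hq).actIsm G ((genuineOfModelIsm S C ε hΔ hq).toIsm G u) x) =
      (genuineOfModelIsm S C ε hΔ hq).actIsm H ((genuineOfModelIsm S C ε hΔ hq).toIsm H u)
        (MulEquivModTorsion (Units.mapEquiv ((genuineOfModelIsm S C ε hΔ hq).mapOtri f)) x) := by
  haveI := C.fact_residueChar_prime
  rw [genuineOfModelIsm_actIsm_toIsm, genuineOfModelIsm_actIsm_toIsm, genuineOfModelIsm_mapOtri,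
    genuineOfModel_mapOtri]
  exact liftM_zhatOxmu_comm C (phiOf C ε f) u x

/-- **`Γ^{×μ} := Im(Ẑ^× → Ism(−))` is preserved — pointwise — by arbitrary isomorphisms `G₁ ⥲ G₂`** ([IUTchII]
Ex. 1.8 (iv) p. 39, the second printed example of a `Γ^{×μ}`), at the fully genuine producer: conjugating the isometry
`toIsm G u ∈ Ism(G)` by `O^{×μ}(f)` yields exactly `toIsm H u ∈ Ism(H)`.  (With abc-iut-L6-d2's `congr_mem_ism` — the
first example `Γ^{×μ} := Ism(−)` — both printed examples are kernel facts for `genuineOfModelIsm`.)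
[claim: Mochizuki2012, status: disputed] (IUTchII §1 Ex 1.8 (iv), kurims p.39) -/
theorem genuineOfModelIsm_congr_actIsm_toIsm {G H : IsoClass S.Gk} (f : G ⟶ H) (u : ZHatUnits) :
    MulAut.congr (MulEquivModTorsion (Units.mapEquiv ((genuineOfModelIsm S C ε hΔ hq).mapOtri f)))
        ((genuineOfModelIsm S C ε hΔ hq).actIsm G ((genuineOfModelIsm S C ε hΔ hq).toIsm G u)) =
      (genuineOfModelIsm S C ε hΔ hq).actIsm H ((genuineOfModelIsm S C ε hΔ hq).toIsm H u) := by
  ext y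
  change MulEquivModTorsion (Units.mapEquiv ((genuineOfModelIsm S C ε hΔ hq).mapOtri f))
      ((genuineOfModelIsm S C ε hΔ hq).actIsm G ((genuineOfModelIsm S C ε hΔ hq).toIsm G u)
        ((MulEquivModTorsion (Units.mapEquiv ((genuineOfModelIsm S C ε hΔ hq).mapOtri f))).symm y)) = _
  rw [genuineOfModelIsm_oxmuMap_actIsm_toIsm, MulEquiv.apply_symm_apply]

/-- Hence the IMAGE SUBGROUP `Im(Ẑ^× → Ism(G))` is carried onto `Im(Ẑ^× → Ism(H))` by conjugation with `O^{×μ}(f)`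
(as subgroups of the automorphism groups of `O^{×μ}`): the printed "collection of closed subgroups … preserved by
arbitrary isomorphisms". [claim: Mochizuki2012, status: disputed] (IUTchII §1 Ex 1.8 (iv), kurims p.39) -/
theorem genuineOfModelIsm_map_range_toIsm {G H : IsoClass S.Gk} (f : G ⟶ H) :
    (((genuineOfModelIsm S C ε hΔ hq).actIsm G).comp ((genuineOfModelIsm S C ε hΔ hq).toIsm G)).range.map
        (MulAut.congr (MulEquivModTorsion (Units.mapEquiv ((genuineOfModelIsm S C ε hΔ hq).mapOtri f)))).toMonoidHom =
      (((genuineOfModelIsm S C ε hΔ hq).actIsm H).comp ((genuineOfModelIsm S C ε hΔ hq).toIsm H)).range := by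
  ext γ
  constructor
  · rintro ⟨_, ⟨u, rfl⟩, rfl⟩
    exact ⟨u, (genuineOfModelIsm_congr_actIsm_toIsm S C ε hΔ hq f u).symm⟩
  · rintro ⟨u, rfl⟩
    exact ⟨_, ⟨u, rfl⟩, genuineOfModelIsm_congr_actIsm_toIsm S C ε hΔ hq f u⟩

end Producer

end AbsTopMonoids

end Literature.IUT.HodgeArakelov

end
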